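import Mathlib.Analysis.Complex.Circle
import Mathlib.Analysis.SpecialFunctions.Complex.Circle
import Mathlib.Topology.Algebra.Group.Pointwise
import Mathlib.Topology.Homeomorph.Lemmas
import Literature.AlgebraicGeometry.Frobenioids.ArchimedeanData
import Literature.AlgebraicGeometry.Frobenioids.CircleOpensArcs
import HarnessLib

/-!
# Frobenioids II, Example 3.3: geometry of the unit circle `O_ℂ^× = S¹` behind the angular regions

Mochizuki, *The geometry of Frobenioids II: poly-Frobenioids*, Kyushu J. Math. **62** (2008)
401–460, §3, Definition 3.1 (iii) and Example 3.3 (i)(ii), author's text pp. 24, 27–28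
[cite: MochizukiFrdII2008, Ex 3.3 (ii) p.28].  PROOF-ONLY infrastructure file (no definition, no
statement of the paper restated) for the discharge of "`C` is a Frobenioid" (Ex. 3.3 (ii), seat
abc-iut-L1-t6's named statement `ArchFrd.Ex33ii_isFrobenioid`): elementary topology of the group
`O_ℂ^×` of units of norm one (abc-iut-L1-t4's `ArchFrd.normOneSubgroup ℂ`, `ArchimedeanData.lean`),
in which the "angular parts" `B` of angular regions live (Def. 3.1 (iii): "an open subset whose
intersection with each connected component of `O_K^×` is [nonempty and] connected").

Contents (all PROVED): `O_ℂ^×` is Mathlib's `Circle` as a topological group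
(`exists_unitCircleEquiv`, an existence statement — no new constant); `O_ℂ^×` is connected, so the
angular part of an angular region of `ℂ^×` is a [nonempty] connected open subset
(`AngularRegion.isConnected_dir`) and conversely every such subset with a tip is an angular region
(`exists_angularRegion`); translates, inverses and products of connected open subsets are connected
open; every open neighbourhood contains a connected open one (`exists_isConnected_isOpen_subset`);
and the rigidity fact behind "angular regions never shrink" (Lemma 3.2 (iv), p. 25): a translate
`w · B` of a connected open `B` contained in `B` equals `B` (`smul_set_eq_self_of_subset`), via the
arc description of connected open subsets of `S¹` (abc-iut-L1-t7's `CircleOpensArcs.lean`, from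
which the strengthened arc-length argument `exists_shift_of_exp_image_Ioo_subset` is adapted).
-/

namespace Literature.AlgebraicGeometry.Frobenioids

open Set Function Topology Real
open scoped Pointwise

namespace ArchFrd

/-! ### Arcs of Mathlib's `Circle` -/

namespace CircleAux

open CircleOpens

/-- **Arc comparison with the shift exhibited** (strengthening of abc-iut-L1-t7's arc-length
monotonicity `CircleOpens.sub_le_sub_of_exp_image_Ioo_subset`, same argument: the lift
`x ↦ lift(exp(ix)) − x` is continuous on `(c₁, d₁)` with values in `2πℤ`, hence constant): if
`exp(i·(c₁, d₁)) ⊆ exp(i·(c, d))` with `d − c ≤ 2π`, then for some `k ∈ ℤ` the shifted interval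
`(c₁ + 2πk, d₁ + 2πk)` lies in `(c, d)`. [cite: MochizukiFrdII2008, Lem 3.2 p.25] -/
theorem exists_shift_of_exp_image_Ioo_subset {c₁ d₁ c d : ℝ} (h₁ : c₁ < d₁) (hcd : d - c ≤ 2 * π)
    (hsub : Circle.exp '' Ioo c₁ d₁ ⊆ Circle.exp '' Ioo c d) :
    ∃ k : ℤ, c ≤ c₁ + k * (2 * π) ∧ d₁ + k * (2 * π) ≤ d := by
  -- adapted from CircleOpensArcs.sub_le_sub_of_exp_image_Ioo_subset (abc-iut-L1-t7)
  have hlift : ∀ x ∈ Ioo c₁ d₁, liftIco c (Circle.exp x) ∈ Ioo c d ∧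
      ∃ k : ℤ, liftIco c (Circle.exp x) - x = k * (2 * π) := by
    intro x hx
    obtain ⟨y, hy, hxy⟩ := hsub ⟨x, hx, rfl⟩
    have hyI : y ∈ Ico c (c + 2 * π) := ⟨hy.1.le, by linarith [hy.2]⟩
    have hl : liftIco c (Circle.exp x) = y := by rw [← hxy, liftIco_exp hyI]
    refine ⟨hl ▸ hy, ?_⟩
    obtain ⟨m, hm⟩ := Circle.exp_eq_exp.mp hxy
    exact ⟨m, by rw [hl, hm]; ring⟩
  set F : ℝ → ℝ := fun x => liftIco c (Circle.exp x) - x with hF_def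
  have hF : ContinuousOn F (Ioo c₁ d₁) := by
    intro x hx
    refine ContinuousAt.continuousWithinAt (ContinuousAt.sub ?_ continuousAt_id)
    refine (continuousAt_liftIco ?_).comp Circle.exp.continuous.continuousAt
    intro e
    have := (hlift x hx).1
    rw [e, liftIco_exp ⟨le_rfl, by linarith [two_pi_pos]⟩] at this
    exact lt_irrefl _ this.1
  have hmaps : MapsTo F (Ioo c₁ d₁) (AddSubgroup.zmultiples (2 * π) : Set ℝ) := by
    intro x hx
    obtain ⟨k, hk⟩ := (hlift x hx).2
    exact ⟨k, by show (k : ℤ) • (2 * π) = F x; rw [zsmul_eq_mul]; exact hk.symm⟩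
  have hdisc : IsDiscrete (AddSubgroup.zmultiples (2 * π) : Set ℝ) :=
    isDiscrete_iff_discreteTopology.mpr
      (inferInstanceAs (DiscreteTopology (AddSubgroup.zmultiples (2 * π))))
  obtain ⟨x₀, hx₀⟩ : (Ioo c₁ d₁).Nonempty := nonempty_Ioo.mpr h₁
  have key : ∀ x ∈ Ioo c₁ d₁, x + F x₀ ∈ Ioo c d := by
    intro x hx
    have hc' := isPreconnected_Ioo.constant_of_mapsTo hdisc hF hmaps hx hx₀
    have : liftIco c (Circle.exp x) = x + F x₀ := by rw [← hc']; simp only [hF_def]; ring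
    rw [← this]
    exact (hlift x hx).1
  have hlow : c ≤ c₁ + F x₀ := by
    by_contra hlt
    rw [not_le] at hlt
    obtain ⟨x, hx₁, hx₂⟩ := exists_between (lt_min h₁ (show c₁ < c - F x₀ by linarith))
    have := (key x ⟨hx₁, lt_of_lt_of_le hx₂ (min_le_left _ _)⟩).1
    have := lt_of_lt_of_le hx₂ (min_le_right _ _)
    linarith
  have hup : d₁ + F x₀ ≤ d := by
    by_contra hlt
    rw [not_le] at hlt
    obtain ⟨x, hx₁, hx₂⟩ := exists_between (max_lt h₁ (show d - F x₀ < d₁ by linarith))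
    have := (key x ⟨lt_of_le_of_lt (le_max_left _ _) hx₁, hx₂⟩).2
    have := lt_of_le_of_lt (le_max_right _ _) hx₁
    linarith
  obtain ⟨k, hk⟩ := (hlift x₀ hx₀).2
  refine ⟨k, ?_, ?_⟩
  · have : F x₀ = k * (2 * π) := hk
    linarith
  · have : F x₀ = k * (2 * π) := hk
    linarith

/-- **A rotation mapping a connected open `E ⊊ S¹` into itself is trivial** ("angular regions never
shrink", the `|n| = 1` case of Lemma 3.2 (iv), p. 25): if `w · E ⊆ E` then `w = 1`.
[cite: MochizukiFrdII2008, Lem 3.2 (iv) p.25] -/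
theorem eq_one_of_smul_subset {E : Set Circle} (hE : IsConnected E) (hEo : IsOpen E)
    (hne : E ≠ univ) {w : Circle} (h : w • E ⊆ E) : w = 1 := by
  obtain ⟨c, d, hcd, hlen, rfl⟩ := exists_eq_exp_image_Ioo hE hEo hne
  obtain ⟨θ, rfl⟩ := Circle.exp_surjective w
  rw [exp_smul_exp_image, image_const_add_Ioo] at h
  obtain ⟨k, hk₁, hk₂⟩ := exists_shift_of_exp_image_Ioo_subset (by linarith) hlen h
  have hθ : θ = (-k : ℤ) * (2 * π) := by push_cast; linarith
  rw [hθ]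
  exact Circle.exp_int_mul_two_pi _

/-- A translate of a connected open `E ⊆ S¹` contained in `E` is all of `E`.
[cite: MochizukiFrdII2008, Lem 3.2 (iv) p.25] -/
theorem smul_eq_self_of_subset {E : Set Circle} (hE : IsConnected E) (hEo : IsOpen E)
    {w : Circle} (h : w • E ⊆ E) : w • E = E := by
  by_cases hne : E = univ
  · rw [hne, smul_set_univ]
  · rw [eq_one_of_smul_subset hE hEo hne h, one_smul]

/-- Every open neighbourhood of a point of `S¹` contains a [nonempty] connected open neighbourhood
(an arc `exp(i·(θ − ε, θ + ε))`). [cite: MochizukiFrdII2008, Lem 3.2 p.25] -/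
theorem exists_isConnected_isOpen_subset {U : Set Circle} (hU : IsOpen U) {p : Circle}
    (hp : p ∈ U) : ∃ V : Set Circle, IsOpen V ∧ IsConnected V ∧ p ∈ V ∧ V ⊆ U := by
  obtain ⟨θ, rfl⟩ := Circle.exp_surjective p
  have hpre : IsOpen (Circle.exp ⁻¹' U) := hU.preimage Circle.exp.continuous
  obtain ⟨ε, hε, hball⟩ := Metric.isOpen_iff.mp hpre θ hp
  refine ⟨Circle.exp '' Ioo (θ - ε) (θ + ε), isOpen_exp_image isOpen_Ioo,
    isConnected_exp_image_Ioo (by linarith), ⟨θ, ⟨by linarith, by linarith⟩, rfl⟩, ?_⟩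
  rintro _ ⟨x, hx, rfl⟩
  apply hball
  rw [Metric.mem_ball, Real.dist_eq, abs_lt]
  exact ⟨by linarith [hx.1], by linarith [hx.2]⟩

end CircleAux

/-! ### `O_ℂ^×` (units of `ℂ` of norm one) is the topological group `S¹` -/

/-- `O_ℂ^× ⊆ ℂ^×` (abc-iut-L1-t4's `normOneSubgroup ℂ`) is isomorphic, as a topological group, to
Mathlib's `Circle`, compatibly with the inclusions into `ℂ` ("`S¹ := O_ℂ^×`", Def. 3.1 (ii), p. 23).
Stated as an existence so that no new constant is introduced. [cite: MochizukiFrdII2008, Def 3.1 (ii) p.23] -/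
theorem exists_unitCircleEquiv :
    ∃ (e : Circle ≃* ↥(normOneSubgroup ℂ)) (h : Circle ≃ₜ ↥(normOneSubgroup ℂ)),
      (∀ z, h z = e z) ∧ ∀ z : Circle, (((e z : ↥(normOneSubgroup ℂ)) : ℂˣ) : ℂ) = (z : ℂ) := by
  let f : Circle →* ↥(normOneSubgroup ℂ) :=
    MonoidHom.codRestrict Circle.toUnits (normOneSubgroup ℂ) circle_toUnits_mem
  have hf_val : ∀ z : Circle, (((f z : ↥(normOneSubgroup ℂ)) : ℂˣ) : ℂ) = (z : ℂ) := fun z => rfl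
  have hf_inj : Function.Injective f := by
    intro z w h
    exact Circle.ext (by rw [← hf_val z, ← hf_val w, h])
  have hf_surj : Function.Surjective f := by
    intro u
    have hu : ‖((u : ℂˣ) : ℂ)‖ = 1 := (mem_normOneSubgroup_iff ℂ (u : ℂˣ)).1 u.2
    refine ⟨⟨((u : ℂˣ) : ℂ), mem_sphere_zero_iff_norm.2 hu⟩, ?_⟩
    apply Subtype.ext
    apply Units.ext
    rfl
  let e : Circle ≃* ↥(normOneSubgroup ℂ) := MulEquiv.ofBijective f ⟨hf_inj, hf_surj⟩
  have hc : Continuous e := by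
    change Continuous (fun z => f z)
    refine Continuous.subtype_mk ?_ _
    refine Units.continuous_iff.2 ⟨?_, ?_⟩
    · exact continuous_subtype_val
    · have hci : Continuous fun z : Circle => ((z⁻¹ : Circle) : ℂ) :=
        continuous_subtype_val.comp (continuous_inv (G := Circle))
      refine hci.congr fun z => ?_
      show ((z⁻¹ : Circle) : ℂ) = (((Circle.toUnits z)⁻¹ : ℂˣ) : ℂ)
      rw [Circle.toUnits_apply, Units.val_inv_eq_inv_val, Units.val_mk0, Circle.coe_inv]
  exact ⟨e, hc.homeoOfEquivCompactToT2 (f := e.toEquiv), fun _ => rfl, fun _ => rfl⟩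

/-- `O_ℂ^×` is connected (the unit circle). [cite: MochizukiFrdII2008, Def 3.1 (iii) p.24] -/
theorem isConnected_univ_normOne : IsConnected (univ : Set ↥(normOneSubgroup ℂ)) := by
  obtain ⟨e, h, -, -⟩ := exists_unitCircleEquiv
  have hC : IsConnected (univ : Set Circle) := by
    rw [← Circle.exp_surjective.range_eq]
    exact isConnected_range Circle.exp.continuous
  have := hC.image h h.continuous.continuousOn
  rwa [image_univ, h.range_coe] at this

/-- The angular part `B ⊆ O_ℂ^×` of an angular region of `ℂ^×` is [nonempty and] connected
(Def. 3.1 (iii): "whose intersection with each connected component of `O_K^×` is [nonempty and]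
connected"; `O_ℂ^×` is connected). [cite: MochizukiFrdII2008, Def 3.1 (iii) p.24] -/
theorem AngularRegion.isConnected_dir (A : AngularRegion ℂ) : IsConnected A.dir := by
  haveI : ConnectedSpace ↥(normOneSubgroup ℂ) :=
    connectedSpace_iff_univ.mpr isConnected_univ_normOne
  have := A.isConnected_inter 1
  rwa [PreconnectedSpace.connectedComponent_eq_univ, inter_univ] at this

/-- Conversely, every [nonempty] connected open `B ⊆ O_ℂ^×` together with a tip `λ ∈ ℝ_{>0}` is (the
data of) an angular region `B × (0, λ]` of `ℂ^×` (Def. 3.1 (iii)).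
[cite: MochizukiFrdII2008, Def 3.1 (iii) p.24] -/
theorem exists_angularRegion {B : Set ↥(normOneSubgroup ℂ)} (hBo : IsOpen B) (hB : IsConnected B)
    (t : PosReal) : ∃ A : AngularRegion ℂ, A.dir = B ∧ A.tip = t := by
  haveI : ConnectedSpace ↥(normOneSubgroup ℂ) :=
    connectedSpace_iff_univ.mpr isConnected_univ_normOne
  exact ⟨⟨B, t, hBo, fun z => by rw [PreconnectedSpace.connectedComponent_eq_univ, inter_univ]; exact hB⟩, rfl, rfl⟩

/-! ### Connected open subsets of `O_ℂ^×`: stability and rigidity -/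

section NormOne

variable {B B₁ B₂ : Set ↥(normOneSubgroup ℂ)}

/-- Products of connected subsets of `O_ℂ^×` are connected (used for `A_L^{⊗d}`, Def. 3.1 (iii)).
[cite: MochizukiFrdII2008, Def 3.1 (iii) p.24] -/
theorem isConnected_mul (h₁ : IsConnected B₁) (h₂ : IsConnected B₂) : IsConnected (B₁ * B₂) := by
  rw [← Set.image_mul_prod]
  exact (h₁.prod h₂).image _ continuous_mul.continuousOn

/-- Products with an open subset of `O_ℂ^×` are open. [cite: MochizukiFrdII2008, Def 3.1 (iii) p.24] -/
theorem isOpen_mul (h₂ : IsOpen B₂) : IsOpen (B₁ * B₂) := h₂.mul_left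

/-- Powers `B^{n+1}` of a connected `B ⊆ O_ℂ^×` are connected. [cite: MochizukiFrdII2008, Def 3.1 (iii) p.24] -/
theorem isConnected_pow (hB : IsConnected B) : ∀ n : ℕ, IsConnected (B ^ (n + 1))
  | 0 => by rwa [zero_add, pow_one]
  | n + 1 => by rw [pow_succ]; exact isConnected_mul (isConnected_pow hB n) hB

/-- Powers `B^{n+1}` of an open `B ⊆ O_ℂ^×` are open. [cite: MochizukiFrdII2008, Def 3.1 (iii) p.24] -/
theorem isOpen_pow (hB : IsOpen B) : ∀ n : ℕ, IsOpen (B ^ (n + 1))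
  | 0 => by rwa [zero_add, pow_one]
  | n + 1 => by rw [pow_succ]; exact isOpen_mul hB

/-- Translates of connected subsets of `O_ℂ^×` are connected. [cite: MochizukiFrdII2008, Def 3.1 (iii) p.24] -/
theorem isConnected_smul (w : ↥(normOneSubgroup ℂ)) (hB : IsConnected B) : IsConnected (w • B) := by
  rw [← Set.image_smul]
  exact hB.image _ (continuous_const_smul w).continuousOn

/-- Translates of open subsets of `O_ℂ^×` are open. [cite: MochizukiFrdII2008, Def 3.1 (iii) p.24] -/
theorem isOpen_smul (w : ↥(normOneSubgroup ℂ)) (hB : IsOpen B) : IsOpen (w • B) := hB.smul w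

/-- Inverses (= complex conjugates) of connected subsets of `O_ℂ^×` are connected.
[cite: MochizukiFrdII2008, Def 3.1 (iv) p.24] -/
theorem isConnected_inv (hB : IsConnected B) : IsConnected B⁻¹ := by
  rw [← Set.image_inv_eq_inv]
  exact hB.image _ continuous_inv.continuousOn

/-- Inverses of open subsets of `O_ℂ^×` are open. [cite: MochizukiFrdII2008, Def 3.1 (iv) p.24] -/
theorem isOpen_inv' (hB : IsOpen B) : IsOpen B⁻¹ := hB.inv

/-- **Rigidity of connected open subsets of `O_ℂ^×` under rotation** ("angular regions never
shrink", Lemma 3.2 (iv), p. 25): if `w · B ⊆ B` for a connected open `B`, then `w · B = B`.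
[cite: MochizukiFrdII2008, Lem 3.2 (iv) p.25] -/
theorem smul_set_eq_self_of_subset (hB : IsConnected B) (hBo : IsOpen B)
    {w : ↥(normOneSubgroup ℂ)} (h : w • B ⊆ B) : w • B = B := by
  obtain ⟨e, H, hHe, -⟩ := exists_unitCircleEquiv
  have hE : IsConnected (H ⁻¹' B) := H.isConnected_preimage.2 hB
  have hEo : IsOpen (H ⁻¹' B) := H.isOpen_preimage.2 hBo
  have hsub : e.symm w • (H ⁻¹' B) ⊆ H ⁻¹' B := by
    rintro _ ⟨z, hz, rfl⟩
    show H (e.symm w • z) ∈ B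
    rw [hHe, smul_eq_mul, map_mul, e.apply_symm_apply]
    exact h ⟨H z, hz, by rw [hHe]; rfl⟩
  have heq := CircleAux.smul_eq_self_of_subset hE hEo hsub
  refine le_antisymm h fun b hb => ?_
  have hb' : H.symm b ∈ H ⁻¹' B := by simpa using hb
  rw [← heq] at hb'
  obtain ⟨z, hz, hzb⟩ := hb'
  refine ⟨H z, hz, ?_⟩
  have := congrArg H hzb
  rw [H.apply_symm_apply] at this
  change H (e.symm w • z) = b at this
  rw [hHe, smul_eq_mul, map_mul, e.apply_symm_apply] at this
  change w • H z = b
  rw [hHe]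
  exact this

/-- Every open neighbourhood of a point of `O_ℂ^×` contains a [nonempty] connected open
neighbourhood (an arc). [cite: MochizukiFrdII2008, Lem 3.2 p.25] -/
theorem exists_isConnected_isOpen_subset {U : Set ↥(normOneSubgroup ℂ)} (hU : IsOpen U)
    {p : ↥(normOneSubgroup ℂ)} (hp : p ∈ U) :
    ∃ V : Set ↥(normOneSubgroup ℂ), IsOpen V ∧ IsConnected V ∧ p ∈ V ∧ V ⊆ U := by
  obtain ⟨e, H, -, -⟩ := exists_unitCircleEquiv
  obtain ⟨V₀, hV₀o, hV₀c, hpV₀, hV₀U⟩ := CircleAux.exists_isConnected_isOpen_subset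
    (H.isOpen_preimage.2 hU) (p := H.symm p) (show H (H.symm p) ∈ U by rwa [H.apply_symm_apply])
  refine ⟨H '' V₀, H.isOpen_image.2 hV₀o, H.isConnected_image.2 hV₀c,
    ⟨H.symm p, hpV₀, H.apply_symm_apply p⟩, ?_⟩
  rintro _ ⟨z, hz, rfl⟩
  exact hV₀U hz

end NormOne

end ArchFrd

end Literature.AlgebraicGeometry.Frobenioids
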